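import Summits.QuantumFields.BalabanUV.Beta.GAN24.SandwichReadoutSiteDep
import Summits.QuantumFields.BalabanUV.Beta.GAN24.StepResolventLegCharges
import Summits.QuantumFields.BalabanUV.Beta.GAN24.MultiplierZeroMass
import Summits.QuantumFields.BalabanUV.Beta.SpineRecursiveW

/-!
# `BalabanUV.Beta.GAN24.CubicPushFaceCharge` — binder row G-an2-4 ∕ (CONV-C), W-slot CT-route, road (U) of the row owner's ruling R-gan24p1-g23-1 ∕ W10
# (journal l.37889 ∕ l.38010: «ONE displayed row F2a-comb `ZfreeSym (b^B_m)` for the comb sources … road W3's `WSlotSourceZeroModeHolds` pattern»);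
# leaf-02 g52's OFFER O-leaf02-g52-1 (l.38064), kernel form: **THE TWO-KERNEL-LEG TOTAL OF A CO-DRESSED CUBIC PUSH IS A FACE-WEIGHTED SANDWICH OF ITS
# VERTEX** — so the first conjunct of W3's `SpureChargeZero.hasSum_unitS_Spure` («the two kernel legs of the S-slot table contract to zero at every stencil
# bond»), which holds for an2's UNDRESSED `Spure m` at every member by the site-free (Q-lin) charges, reads for the COMB S-slot `SpureRecAt ρ (m+1)` as a
# TWO-FACE sum of the vertex of the previous member (DISPLAYED below, no value asserted; the owner's R4 l.38256 finds the assembled comb source charge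
# `Z(b^B_1)` ZERO at D = 2, Bc = 1 — so these face sums cancel in the (S3c)-comb assembly there; leaf-02's prediction P-leaf02-g52-2 that they would not is
# WITHDRAWN for that geometry)

NOT IN PRINT; OUR BOOKKEEPING (G-an2-4 crux team (2), leaf prover `b2b-balaban-gan24-formalise-leaf-02`, gen 52).  PRIOR ART BY NAME, nothing re-derived:
the face-weighted sandwich read-out through a co-dressed kernel is gan24-p2 g36's `SandwichReadoutSiteDep.hasSum_sandwich_readout_coDressKBmAt` (p311535 ✓,
my XREAD C-gan24leaf02-g52-1); the four coarse-leg charges of `KInvStep Lc j` are leaf-06's `StepResolventLegCharges.hasSum_KInvStep_inr_inl ∕ _inl_inr` +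
`MultiplierZeroMass.hasSum_KInvStep_mm_left ∕ _right`; the cubic push `e3OfK` is an2's (`SpineRooted`), the comb S-slot `SpureRecAt` is leaf-10's
(`SpineRecursiveW`), its locality `WardLocusRecursive.locStencil_SrecAt`; the vertex is an2's `vertexOfK` (`vertexFamily_vertexOfK`).  HONEST FRAMING (cell
contract, verbatim): «discharging `BetaPertH` makes Bałaban's UV stability UNCONDITIONAL — a real constructive-QFT result; it is NOT the continuum limit and
NOT the Clay problem.»  HONEST DEPENDENCY (verbatim): «continuum YM on T⁴ ⇐ BetaPertH ∧ nine spine estimates (0/9 proved); BetaPertH ⇐ (D1) ∧ (D4) ∧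
CAP+tail; G-an2-4 gates asym, D1 and NE2/3/4.»  [folklore] bookkeeping; generic `d`, in-block root, `1 ≤ N`; 0 `def`, 0 cited facts, 0 `def … : Prop`,
0 sorry.  Asserts NO value of Bałaban's tables (the face sums are DISPLAYED, not evaluated); discharges NOTHING of «F2a-comb» ∕ (U) ∕ «T2Shape» ∕ (hW, hWall);
0 wall binders; NEVER «G-an2-4 closed» as (CONV-C); NOT D1, NOT BetaPertH, NOT continuum, NOT Clay.

## What (`ρ = toSite r`, `r ∈ box (d+1) N`)
* §1 **`hasSum_prod_e3OfK_coDressKBmAt_inl_inl`** (generic decaying `K` with site-free field-leg charges `cL ∕ cR` and zero multiplier-leg charges — p2's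
  four hypotheses; local `S`): `HasSum ((x′,z′) ↦ e3OfK N (coDressKBmAt ρ N K) S κ′ u′ x′ z′ (inl α) (inl β)) (−Σ'_{(y,w)} Σ_{a,b} [y_a % N = N−1]·N·cL α a ·
  (vertexOfK (coDressKBmAt ρ N K) N S κ′ u′) y w (inl a) (inl b) · [w_b % N = N−1]·N·cR b β)` — the ff two-kernel-leg total of the co-dressed cubic push at a
  FIXED stencil bond reads its vertex on the EXIT-FACE bond pairs only.
* §2 **`hasSum_prod_e3OfK_coDress_KInvStep_inl_inl`** (the comb kernel `G_j = coDressKBmAt ρ Lc (KInvStep Lc j)`, no hypothesis but locality of `S`):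
  the total is `+Lc²·σ_j²·Σ'_{(y,w)} [y_α % Lc = Lc−1 ∧ w_β % Lc = Lc−1]·(vertexOfK G_j Lc S κ′ u′) y w (inl α) (inl β)`, `σ_j = ((Lc^{j+1})^{d+2})⁻¹`
  — CONTRAST an2's undressed push, where the same total is `σ_j²·Σ'_{(y,w)} (vertex)` and vanishes by (S3c) of `S` (`ValueJetChargeZero`).
* §3 **`hasSum_prod_SpureRecAt_succ_inl_inl`**: for leaf-10's comb S-slot, `Σ'_{(x,z)} SpureRecAt ρ … (j+1) κ′ u′ x z (inl α) (inl β) =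
  (cE·wE (j+1))·Lc²·σ_j²·(two-face sum of the vertex of `SrecAt ρ … j` through `G_j`)` (the rooted border `vhSAt` is off the ff block) — THE LOCATED FORM
  OF ROW «F2a-comb», first (S3c) conjunct: a face identity of member `j`, not a consequence of its plain two-leg charges.
-/

noncomputable section

open Finset
open scoped BigOperators
open Literature.MathematicalPhysics.QuantumFieldTheory
open Literature.MathematicalPhysics.QuantumFieldTheory.Balaban1983to89
open Literature.MathematicalPhysics.QuantumFieldTheory.Balaban1983to89.Beta
open ExpKernelCalculus (Site MKer BiLoc Decays comp Zl)
open OneStepResolventKernel (Fib LocStencil decays_mono)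
open AffineAveraging (box toSite)
open OneStepKernelFamily (KInvStep decays_KInvStep vertexOfK vertexFamily_vertexOfK)
open BalabanStepJets (locStencil_mono)
open BalabanStepJetsSucc (mmRead mmRead_inl_inl wE wVH)
open Summit.QuantumFields.BalabanUV.Beta.AxialDressingRooted (coDressKBmAt decays_coDressKBmAt)
open AveragingHessianKernelsRooted (vhSAt)
open Summit.QuantumFields.BalabanUV.Beta.SpineRooted (e3OfK e3OfK_apply SpureRecAt SpureRecAt_succ)
open Summit.QuantumFields.BalabanUV.Beta.WardLocusRecursive (SrecAt locStencil_SrecAt)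
open Summit.QuantumFields.BalabanUV.Beta.GAN24.SandwichReadoutSiteDep (hasSum_sandwich_readout_coDressKBmAt)
open Summit.QuantumFields.BalabanUV.Beta.GAN24.StepResolventLegCharges (hasSum_KInvStep_inr_inl hasSum_KInvStep_inl_inr)
open Summit.QuantumFields.BalabanUV.Beta.GAN24.MultiplierZeroMass (hasSum_KInvStep_mm_left hasSum_KInvStep_mm_right)

namespace Summit.QuantumFields.BalabanUV.Beta.GAN24.CubicPushFaceCharge

variable {d : ℕ} {N : ℕ} {r : Fin (d + 1) → ℕ}

/-! ## §1 The ff two-kernel-leg total of a co-dressed cubic push -/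

/-- NOT IN PRINT; OUR BOOKKEEPING.  **THE TWO-KERNEL-LEG TOTAL OF A CO-DRESSED CUBIC PUSH READS ITS VERTEX ON THE EXIT FACES** (in-block root `ρ = toSite r`,
`1 ≤ N`; `K` decaying with SITE-FREE field-leg charges `cL ∕ cR` against the multiplier legs and ZERO multiplier-leg charges — gan24-p2's four hypotheses;
`S` a local stencil family): for every stencil bond `(κ′,u′)`,
`HasSum ((x′,z′) ↦ e3OfK N (coDressKBmAt ρ N K) S κ′ u′ x′ z′ (inl α) (inl β)) (−Σ'_{(y,w)} Σ_{a,b} [y_a % N = N−1]·N·cL α a · (vertexOfK (coDressKBmAt ρ N K) N S κ′ u′) y w (inl a) (inl b) · [w_b % N = N−1]·N·cR b β)`.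
(`e3OfK N G S κ′ u′ x′ z′ (inl α) (inl β) = −(G ∘ vertexOfK G N S κ′ u′ ∘ G)(N•x′, N•z′)_{(inr α, inr β)}` by definition; gan24-p2's
`hasSum_sandwich_readout_coDressKBmAt` at the bi-localised vertex.) -/
theorem hasSum_prod_e3OfK_coDressKBmAt_inl_inl [NeZero N] (hN : 1 ≤ N) (hr : r ∈ box (d + 1) N) {K : MKer (d + 1) (Fib d)} {C δ : ℝ}
    (hK : Decays K C δ) (hδ : 0 < δ) {S : Fin (d + 1) → Site (d + 1) → MKer (d + 1) (Fib d)} {Cs δs : ℝ} (hS : LocStencil S Cs δs) (hδs : 0 < δs)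
    {cL cR : Fin (d + 1) → Fin (d + 1) → ℝ}
    (hL : ∀ (t : Fin (d + 1) → ℤ) (α κ : Fin (d + 1)), HasSum (fun x' : Fin (d + 1) → ℤ => K ((N : ℤ) • x') t (Sum.inr α) (Sum.inl κ)) (cL α κ))
    (hL0 : ∀ (t : Fin (d + 1) → ℤ) (α m : Fin (d + 1)), HasSum (fun x' : Fin (d + 1) → ℤ => K ((N : ℤ) • x') t (Sum.inr α) (Sum.inr m)) 0)
    (hR : ∀ (u : Fin (d + 1) → ℤ) (κ' μ : Fin (d + 1)), HasSum (fun y : Fin (d + 1) → ℤ => K u ((N : ℤ) • y) (Sum.inl κ') (Sum.inr μ)) (cR κ' μ))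
    (hR0 : ∀ (u : Fin (d + 1) → ℤ) (m μ : Fin (d + 1)), HasSum (fun y : Fin (d + 1) → ℤ => K u ((N : ℤ) • y) (Sum.inr m) (Sum.inr μ)) 0)
    (κ' : Fin (d + 1)) (u' : Site (d + 1)) (α β : Fin (d + 1)) :
    HasSum (fun xz : Site (d + 1) × Site (d + 1) => e3OfK N (coDressKBmAt (toSite r) N K) S κ' u' xz.1 xz.2 (Sum.inl α) (Sum.inl β))
      (-(∑' yw : Site (d + 1) × Site (d + 1), ∑ a : Fin (d + 1), ∑ b : Fin (d + 1),
        (if yw.1 a % (N : ℤ) = (N : ℤ) - 1 then (N : ℝ) * cL α a else 0) *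
          vertexOfK (coDressKBmAt (toSite r) N K) N S κ' u' yw.1 yw.2 (Sum.inl a) (Sum.inl b) *
          (if yw.2 b % (N : ℤ) = (N : ℤ) - 1 then (N : ℝ) * cR b β else 0))) := by
  -- the vertex through the co-dressed kernel is bi-localised (common rate)
  obtain ⟨δG, CG, hδG, hCG, hG⟩ := decays_coDressKBmAt hN hr (K := K) ⟨δ, C, hδ, hK.nonneg (Sum.inl 0), hK⟩
  have hCs : 0 ≤ Cs := (hS 0 0).nonneg (Sum.inl 0)
  set m : ℝ := min δs δG with hm
  have hm0 : 0 < m := lt_min hδs hδG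
  have hSm : LocStencil S Cs m := locStencil_mono hS hCs (min_le_left _ _)
  have hV := vertexFamily_vertexOfK (N := N) hG hCG hSm hm0 (min_le_right _ _) κ' u'
  have h := hasSum_sandwich_readout_coDressKBmAt hN hr hK hδ hV (half_pos hm0) α β hL hL0 hR hR0
  refine h.neg.congr_fun fun xz => ?_
  rw [e3OfK_apply, mmRead_inl_inl]

/-! ## §2 The comb kernel `G_j = coDressKBmAt ρ Lc (KInvStep Lc j)`: `+Lc²·σ_j²` times the two-face sum of the vertex -/

/-- [folklore] Folding gan24-p2's fibre double sum at the Kronecker charges of `KInvStep`: only `(a,b) = (α,β)` survives, with the two face weights. -/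
theorem sum_sum_face_kron (Lc : ℕ) (σ : ℝ) (V : Fib d → Fib d → ℝ) (y w : Site (d + 1)) (α β : Fin (d + 1)) :
    ∑ a : Fin (d + 1), ∑ b : Fin (d + 1),
        (if y a % (Lc : ℤ) = (Lc : ℤ) - 1 then (Lc : ℝ) * (-(if a = α then σ else 0)) else 0) * V (Sum.inl a) (Sum.inl b) *
          (if w b % (Lc : ℤ) = (Lc : ℤ) - 1 then (Lc : ℝ) * (if b = β then σ else 0) else 0)
      = -((Lc : ℝ) ^ 2 * σ ^ 2 * (if y α % (Lc : ℤ) = (Lc : ℤ) - 1 ∧ w β % (Lc : ℤ) = (Lc : ℤ) - 1 then V (Sum.inl α) (Sum.inl β) else 0)) := by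
  rw [Finset.sum_eq_single α ?_ (fun h => absurd (Finset.mem_univ α) h)]
  · rw [Finset.sum_eq_single β ?_ (fun h => absurd (Finset.mem_univ β) h)]
    · simp only [if_true]
      by_cases hy : y α % (Lc : ℤ) = (Lc : ℤ) - 1
      · by_cases hw : w β % (Lc : ℤ) = (Lc : ℤ) - 1
        · rw [if_pos hy, if_pos hw, if_pos ⟨hy, hw⟩]; ring
        · rw [if_pos hy, if_neg hw, if_neg (not_and_of_not_right _ hw)]; ring
      · rw [if_neg hy, if_neg (not_and_of_not_left _ hy)]; ring
    · intro b _ hb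
      rw [if_neg hb, mul_zero, ite_self, mul_zero]
  · intro a _ ha
    refine Finset.sum_eq_zero fun b _ => ?_
    rw [if_neg ha, neg_zero, mul_zero, ite_self, zero_mul, zero_mul]

/-- NOT IN PRINT; OUR BOOKKEEPING.  **THE COMB INSTANCE** (in-block root, `Lc ≥ 1`, every `j`, ANY local stencil family `S`; NO charge hypothesis — the four
coarse-leg charges of `KInvStep Lc j` are leaf-06's tree theorems): with `G_j = coDressKBmAt ρ Lc (KInvStep Lc j)` and `σ_j = ((Lc^{j+1})^{d+2})⁻¹`,
`HasSum ((x′,z′) ↦ e3OfK Lc G_j S κ′ u′ x′ z′ (inl α) (inl β)) (Lc²·σ_j²·Σ'_{(y,w)} [y_α % Lc = Lc−1 ∧ w_β % Lc = Lc−1]·(vertexOfK G_j Lc S κ′ u′) y w (inl α) (inl β))`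
— the ff two-kernel-leg total of the CO-DRESSED cubic push at a fixed stencil bond is `Lc²·σ_j²` times the TWO-FACE sum of its vertex (CONTRAST the undressed
push `e3OfK Lc (KInvStep Lc j) S`, whose total is `σ_j²·Σ'_{(y,w)} vertex` — site-free charges — and vanishes by (S3c) of `S`, an2∕leaf-06's
`ValueJetChargeZero` ∕ `SpureChargeZero`). -/
theorem hasSum_prod_e3OfK_coDress_KInvStep_inl_inl {Lc : ℕ} [NeZero Lc] {r : Fin (d + 1) → ℕ} (hr : r ∈ box (d + 1) Lc) (j : ℕ)
    {S : Fin (d + 1) → Site (d + 1) → MKer (d + 1) (Fib d)} {Cs δs : ℝ} (hS : LocStencil S Cs δs) (hδs : 0 < δs)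
    (κ' : Fin (d + 1)) (u' : Site (d + 1)) (α β : Fin (d + 1)) :
    HasSum (fun xz : Site (d + 1) × Site (d + 1) =>
        e3OfK Lc (coDressKBmAt (toSite r) Lc (KInvStep (d := d) Lc j)) S κ' u' xz.1 xz.2 (Sum.inl α) (Sum.inl β))
      ((Lc : ℝ) ^ 2 * (((((Lc ^ (j + 1) : ℕ) : ℝ)) ^ (d + 1 + 1))⁻¹) ^ 2 *
        ∑' yw : Site (d + 1) × Site (d + 1),
          (if yw.1 α % (Lc : ℤ) = (Lc : ℤ) - 1 ∧ yw.2 β % (Lc : ℤ) = (Lc : ℤ) - 1 then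
            vertexOfK (coDressKBmAt (toSite r) Lc (KInvStep (d := d) Lc j)) Lc S κ' u' yw.1 yw.2 (Sum.inl α) (Sum.inl β) else 0)) := by
  have hLc : 1 ≤ Lc := Nat.one_le_iff_ne_zero.2 (NeZero.ne Lc)
  obtain ⟨δ, C, hδ, -, hK⟩ := decays_KInvStep (d := d) (Lc := Lc) j
  have h := hasSum_prod_e3OfK_coDressKBmAt_inl_inl hLc hr hK hδ hS hδs
    (cL := fun α κ => -(if κ = α then ((((Lc ^ (j + 1) : ℕ) : ℝ)) ^ (d + 1 + 1))⁻¹ else 0))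
    (cR := fun κ' μ => if κ' = μ then ((((Lc ^ (j + 1) : ℕ) : ℝ)) ^ (d + 1 + 1))⁻¹ else 0)
    (fun t α κ => hasSum_KInvStep_inr_inl j α κ t) (fun t α m => hasSum_KInvStep_mm_left j α m t)
    (fun u κ' μ => hasSum_KInvStep_inl_inr j κ' μ u) (fun u m μ => hasSum_KInvStep_mm_right j m μ u) κ' u' α β
  simp only [sum_sum_face_kron] at h
  rw [tsum_neg, neg_neg, tsum_mul_left] at h
  exact h

/-! ## §3 The comb S-slot: the two-kernel-leg total of `SpureRecAt ρ (j+1)` -/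

/-- [folklore] The rooted (V-H) border is off the field–field block (an1's packer; `rfl`). -/
theorem vhSAt_inl_inl (ρ : Fin (d + 1) → ℤ) (L : ℕ) (κ : Fin (d + 1)) (u x y : Site (d + 1)) (α β : Fin (d + 1)) :
    vhSAt ρ d L rfl κ u x y (Sum.inl α) (Sum.inl β) = 0 := rfl

/-- NOT IN PRINT; OUR BOOKKEEPING.  **THE LOCATED FORM OF ROW «F2a-comb», FIRST (S3c) CONJUNCT** (in-block root, `Lc ≥ 1`, every `j`, all `cE cVH cΛ`): the ff
two-kernel-leg total of member `j+1` of leaf-10's comb S-slot at a fixed stencil bond is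
`HasSum ((x,z) ↦ SpureRecAt ρ cE cVH cΛ (j+1) κ′ u′ x z (inl α) (inl β)) ((cE·wE (j+1))·Lc²·σ_j²·Σ'_{(y,w)} [y_α, w_β at exit faces]·(vertexOfK G_j Lc (SrecAt ρ … j) κ′ u′) y w (inl α) (inl β))`
(`SpureRecAt_succ`: cubic push + rooted border; the border is off the ff block).  For an2's UNDRESSED `Spure (j+1)` the same total is ZERO
(`SpureChargeZero.hasSum_Spure`, first conjunct) — the W3 plug `WSlotSourceZeroModeHolds` consumes exactly that zero; for the comb S-slot it is the
two-face sum of the previous member's vertex, a property of that TABLE (by the owner's R4 numerics the assembled source charge vanishes at D = 2, Bc = 1: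
the face sums cancel in the assembly there — this theorem displays the term and asserts no value). -/
theorem hasSum_prod_SpureRecAt_succ_inl_inl {Lc : ℕ} [NeZero Lc] {r : Fin (d + 1) → ℕ} (hr : r ∈ box (d + 1) Lc) (cE cVH cΛ : ℝ) (j : ℕ)
    (κ' : Fin (d + 1)) (u' : Site (d + 1)) (α β : Fin (d + 1)) :
    HasSum (fun xz : Site (d + 1) × Site (d + 1) =>
        SpureRecAt d Lc (toSite r) cE cVH cΛ (j + 1) κ' u' xz.1 xz.2 (Sum.inl α) (Sum.inl β))
      ((cE * wE d Lc (j + 1)) * ((Lc : ℝ) ^ 2 * (((((Lc ^ (j + 1) : ℕ) : ℝ)) ^ (d + 1 + 1))⁻¹) ^ 2 *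
        ∑' yw : Site (d + 1) × Site (d + 1),
          (if yw.1 α % (Lc : ℤ) = (Lc : ℤ) - 1 ∧ yw.2 β % (Lc : ℤ) = (Lc : ℤ) - 1 then
            vertexOfK (coDressKBmAt (toSite r) Lc (KInvStep (d := d) Lc j)) Lc (SrecAt d Lc (toSite r) cE cVH cΛ j) κ' u' yw.1 yw.2
              (Sum.inl α) (Sum.inl β) else 0))) := by
  have hLc : 1 ≤ Lc := Nat.one_le_iff_ne_zero.2 (NeZero.ne Lc)
  obtain ⟨Cs, δs, hδs, hS⟩ := locStencil_SrecAt (d := d) (Lc := Lc) hLc hr cE cVH cΛ j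
  have h := (hasSum_prod_e3OfK_coDress_KInvStep_inl_inl hr j hS hδs κ' u' α β).mul_left (cE * wE d Lc (j + 1))
  refine h.congr_fun fun xz => ?_
  simp only [SpureRecAt_succ, Pi.add_apply, Pi.smul_apply, smul_eq_mul, vhSAt_inl_inl, mul_zero, add_zero]

end Summit.QuantumFields.BalabanUV.Beta.GAN24.CubicPushFaceCharge

end
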